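import Literature.MathematicalPhysics.QuantumFieldTheory.Balaban1983to89.B9Thm313WholeDvHolderAtPinsGraded
import Literature.MathematicalPhysics.QuantumFieldTheory.Balaban1983to89.B9Thm313WholeDvHolderFromDdsFree
import Literature.MathematicalPhysics.QuantumFieldTheory.Balaban1983to89.B9GradViaDivLettersPrintWeight

/-!
# `Balaban1983to89.B9Thm313WholeDvHolderAtPinsPrint` — THE D_U-ORBIT HÖLDER-SOURCE MEMBERS OF ROWS 20–21 AT THE PRINT-WEIGHTED PIN (P2′)
# `bH13 := bHZPG (taxiS U) w` (`B9SmoothHolderClassP`): `D\*G₀D_U`, `∇_{U,ν}G₀D_U`, `∇_UG₀D_U`, `Φ^Y_β∘∇_UG₀D_U` from PRINT-LITERAL directional (3.44)∕(3.45)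
# members at `bHZKP (taxiB U) s` and the print-weighted transported `J`-letter — the (R4′) twins of `…AtPinsGraded` §1, no length juggling

T. Bałaban, *Propagators for lattice gauge theories in a background field*, Commun. Math. Phys. **99** (1985) 389–434
[`Balaban1985BackgroundPropagators`, "B9"]; [4] = T. Bałaban, *Propagators and renormalization transformations for lattice gauge
theories. II*, Commun. Math. Phys. **96** (1984) 223–250 [`Balaban1984PropagatorsII`].

statement-level skeleton of published theorems with citation tags; proofs where landed; nothing here is a claim about the
Yang–Mills mass gap

THE PRINTED LOCI.  [B9] Thm 3.1 (3.44)–(3.45) p. 398 (input functional `‖λ‖^{ξ′}_ε + |λ|`), Thm 3.3 p. 399 (G₀ = G(U)), (3.3) p. 390, Thm 3.13 (3.152)–(3.153) p. 426;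
[4] (2.52)–(2.56) pp. 232–233, Lemma 2.1 (2.60)–(2.61) p. 234.

WHY THIS FILE (cell `pub-ymgap`, node N06, seat dag-n06-l g24; repair (A′) of LOCATED-U6, `BH13-UNITS-MEMO.md`, step (R4′)).  At the print-weighted pins the
intermediate classes certify length-dimension 1 in both channels, so: the `J`-letter `bHZPG (taxiS U) w → bHZKP (taxiB U) s` is LENGTH-FREE
(`B9GradViaDivLettersPrintWeight.hasMaj_JcoKH_printGraded`, constant `CJG(s)·L^{1−s}`, rate `δ_J − αδ_F`), and the displayed directional members are PRINT-LITERAL: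
`h44Ds′ μ : bHZKP s → 𝔠_W⁽⁰⁾` (D\*G₀∇\*_{U,μ}), `h44m′ ν μ : bHZKP s → 𝔠⁽¹⁾` (∇_{U,ν}G₀∇\*_{U,μ}; (3.44) literally), `h45Y′ μ : bHZKP s → 𝔠_{P_Y}^{(β−1)}`
(Φ^Y_β∘∇_UG₀∇\*_{U,μ}; (3.45) literally, `s = β + ε`).  THIS FILE composes them (engines `h44DsDv_of_h44Ds` (g18) and `…FromDdsFree` (g24)):
* §1 ★★ `h44DsDv_pins_print` (`Thm33G0DivR.h44DsDv` at (P2′): `BdD ≥ (d+1)(1+C_Lip)·B_iD·(CJG(s)·L^{1−s})·c`, rate `δ₃ ≤ δ₀`, `δ₃ + σ ≤ δ_J − αδ_F`),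
  ★★ `dgDHd_pins_print` (`Letters313DMZ.dgDHd ν`), ★★ `dgDH_pins_print` (`Letters313DZ.dgDH`, slice-diagonal `∇_U`), ★★ `pYDH_pins_print` (`Letters313HZ.pYDH β`; v1.1 `pYDH_pins_print'` with the probe-lattice type `PX` free).
Compared with `…AtPinsGraded` §1: the source is `bHZPG` (no outer `weightNorm … (Lʲη)⁻¹`), the inputs' targets are `𝔠⁽¹⁾ ∕ 𝔠_P^{(β−1)}` instead of the sharp blocks,
no `Facts347`-transfer of a length is needed for `dgDHd ∕ dgDH ∕ pYDH` (only the `J`-letter's own (2.60) rate shift `αδ_F`), and every displayed input is a verbatim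
(3.44)∕(3.45) instance at a class whose unit member has `‖λ‖^{ξ′}_s + |λ| ≤ 2Lʲ′η`.
HONEST SCOPE.  Kernel bookkeeping over landed modules; the directional members and the plaquette binder are HYPOTHESES of printed species; nothing of [B9]∕[4]
asserted; no certificate edit; COUNT-NEUTRAL; N06 NOT discharged; nothing continuum, nothing about the mass gap.  Cell `pub-ymgap` (HUMAN RULING D-0062), Track A
node N06 [B9], seat `pub-ymgap-dag-n06-l` (g24), 2026-08-29.
-/

noncomputable section

namespace Literature.MathematicalPhysics.QuantumFieldTheory.Balaban1983to89.B9Thm313WholeDvHolderAtPinsPrint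

open scoped Matrix.Norms.L2Operator
open Node00 B6GlobalChartV1 B6KLevelCensusIndexV1
open B6Geom246MultiLevelTorus (geomT)
open B6Ineq2142KLevelV1 (β)
open B11SectG (HasMaj RowSum BlockNorm)
open B9Thm34Ext (toB6)
open B9Thm312Whole (cNorm GeoOK Ops)
open B9Thm312WholeClasses (cNormR)
open B9RWSums343to347Whole (Facts347)
open B9Thm39ReadingCoords (cR39 cR39_nonneg)
open B9CoReadingCoords (XBK coordOpK cdBₗ cdsBₗ blkBK)
open B9CoReadingCoordsS (XSK blkSK sIK)
open B7Prop2SpecialUnitary (specialUnitaryUnits specialUnitaryUnits_le_U1)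
open Node00.OpsYSectDCoords (DvcoKH)
open B9GeoNormsKLevelV1 (geo9K)
open B9GradViaDivLettersAtPins (JcoKH sliceProjK DvcoKH_eq_sum DcoK_eq_sum)
open B9Thm313WholeDvHolderFromDds (h44DsDv_of_h44Ds)
open B9Thm313WholeDvHolderFromDdsFree (dgDHd_of_h44m_one dgDH_of_h44m_one pYDH_of_h45Y_one)
open B9Thm313WholeDvHolderAtPins (hasMaj_sliceProjK_cNorm)
open B9RWSums343Holder (HolderProbes)
open B9Thm313WholeDvHolderAtPinsGraded (thetaL thetaL_nonneg CJG CJG_nonneg)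
open B9MultiscaleSmoothPartitionYLip (CLip CLip_nonneg)
open B9SmoothHolderClassP (bHZKP bHZKP_κ bHZPG)
open B9GradViaDivLettersPrintWeight (hasMaj_JcoKH_printGraded)
open B9TaxiTransportLadder (plaqV)
open B9GradViaDivLettersTransported (taxiS taxiB)
open Node00.OpsYNablaBridge (chartY)

variable {d ℓ : ℕ} {hd : 1 ≤ d + 1} {hL : Odd (ℓ + 1) ∧ 1 < ℓ + 1} {b₀ b₁ : ℝ}
variable (i : KIdx d ℓ hd hL b₀ b₁) [Fintype (geo9K i).Site] {κ : Type} [Fintype κ]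

section Members

variable {N : ℕ} [NeZero N] (B : B9.Backgrounds) (rd : B.Cfg → CfgY (Matrix (Fin N) (Fin N) ℂ) i) (b : Module.Basis κ ℝ (Matrix (Fin N) (Fin N) ℂ))
variable {bI : FBondY i → IBondY i}
variable (w : ℝ → ℝ) (hw0 : ∀ s, 0 ≤ w s) (hw1 : ∀ s, w s ≤ 1) {s : ℝ} (hs0 : 0 < s) (hs1 : s < 1) (hws : 0 < w s)
include hws

omit [NeZero N] in
/-- the print-weighted `J`-letter out of the graded pin, with the s-uniform constant `CJG(s)·L` and rate `δ_J − αδ_F` (`L^{1−s} ≤ L`). [cite: Balaban1985BackgroundPropagators, (3.3) p.390 + (3.45) p.398; Balaban1984PropagatorsII, Lemma 2.1 (2.60) p.234] -/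
theorem hJ_print {R₀ : ℝ} {H₀ : Prop} {dF : ℕ} {δF α L₀ : ℝ} (hFa : Facts347 (geo9K i) R₀ H₀ dF δF α L₀)
    (hcf : |i.cf| = (B6Prop22KLevelTorusCensusEta.nKT (toKT i) : ℝ))
    (hβ1 : ∀ f : FBondY i, (geomT i.D).dist (β i.hN i.D i.hk (bI f)) (blkV1 i.hN i.D f) ≤ 1)
    (hbI0 : ∀ f : FBondY i, bI f = bI ⟨f.src, 0⟩) {U : B.Cfg}
    (hU : ∀ (ν : Fin (d + 1)) (x : Site (PV d ℓ i.m i.K hd hL) 0), ‖(rd U ν x : Matrix (Fin N) (Fin N) ℂ)‖ ≤ 1 ∧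
      ‖(((rd U ν x)⁻¹ : (Matrix (Fin N) (Fin N) ℂ)ˣ) : Matrix (Fin N) (Fin N) ℂ)‖ ≤ 1)
    {ϑF : ℝ} (hϑF : 0 ≤ ϑF)
    (hF : ∀ (y : Site (PV d ℓ i.m i.K hd hL) 0) (μ' ν' : Fin (d + 1)),
      ‖(plaqV (rd U) y μ' ν' : Matrix (Fin N) (Fin N) ℂ) - 1‖ ≤ ϑF * ((((ℓ + 1 : ℕ) : ℝ)) ^ levY i (chartY i y))⁻¹)
    {δJ : ℝ} (hδJ : 0 ≤ δJ) (μ : Fin (d + 1)) :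
    HasMaj (bHZPG (κ := κ) i b (taxiS i B rd U) (R := R₀) (H := H₀) w hw0 hw1)
      (bHZKP (κ := κ) i b (taxiB i B rd U) (R := R₀) (H := H₀) (s := s) hs0.le hs1.le) (JcoKH i b B rd μ U)
      (fun a a' => CJG d ℓ b s (thetaL d ℓ ϑF) (w s) δJ * (geo9K i).L * Real.exp (-((δJ - α * δF) * (geo9K i).dist a a'))) := by
  have hL1 : 1 ≤ (geo9K i).L := hFa.one_le_L
  refine (hasMaj_JcoKH_printGraded i b B rd hFa hcf w hw0 hw1 hs0 hs1 hws hβ1 hbI0 hU hϑF hF hδJ μ).mono fun a a' => ?_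
  have hLs : (geo9K i).L ^ (1 - s) ≤ (geo9K i).L := by
    conv_rhs => rw [← Real.rpow_one (geo9K i).L]
    exact Real.rpow_le_rpow_of_exponent_le hL1 (by linarith)
  have hC : 0 ≤ CJG d ℓ b s (thetaL d ℓ ϑF) (w s) δJ := CJG_nonneg (d := d) (ℓ := ℓ) b (thetaL_nonneg d ℓ hϑF) hws δJ
  unfold CJG thetaL at hC ⊢
  calc (w s)⁻¹ * (cR39 b * B9GradViaDivLettersTransported.CJT b ℓ s (2 * ((d : ℝ) + 1) * (((ℓ + 1 : ℕ) : ℝ)) ^ 2 * ϑF) *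
        Real.exp (δJ * B9GradViaDivLettersSmoothTerms.rZ d ℓ (B9MultiscaleSmoothPartitionYNear.rNear d ℓ + 1)) * (geo9K i).L ^ (1 - s) *
        Real.exp (-((δJ - α * δF) * (geo9K i).dist a a')))
      = (w s)⁻¹ * (cR39 b * B9GradViaDivLettersTransported.CJT b ℓ s (2 * ((d : ℝ) + 1) * (((ℓ + 1 : ℕ) : ℝ)) ^ 2 * ϑF) *
          Real.exp (δJ * B9GradViaDivLettersSmoothTerms.rZ d ℓ (B9MultiscaleSmoothPartitionYNear.rNear d ℓ + 1))) * (geo9K i).L ^ (1 - s) *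
          Real.exp (-((δJ - α * δF) * (geo9K i).dist a a')) := by ring
    _ ≤ _ := mul_le_mul_of_nonneg_right (mul_le_mul_of_nonneg_left hLs hC) (Real.exp_nonneg _)

/-- ★★ **`Thm33G0DivR.h44DsDv` AT THE PRINT-WEIGHTED PIN** — D\*G₀D_U : `bHZPG (taxiS U) w → 𝔠_W⁽⁰⁾` from the directional members `h44Ds′ μ` at `bHZKP (taxiB U) s` (target
𝔠_W⁽⁰⁾, the certificate's letter class) and the print-weighted J-letter; `B_dD ≥ (d+1)·(1 + C_Lip)·B_iD·(CJG(s)·L)·c`, `0 ≤ δ₃ ≤ δ₀`, `δ₃ + σ ≤ δ_J − αδ_F`.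
[cite: Balaban1985BackgroundPropagators, Thm 3.3 (3.44) p.398 + (3.3) p.390 + (3.35) p.396; Balaban1984PropagatorsII, (2.26) p.228 + (2.52)–(2.56) pp.232–233 + Lemma 2.1 (2.60)–(2.61) p.234] -/
theorem h44DsDv_pins_print {R₀ : ℝ} {H₀ : Prop} {dF : ℕ} {δF α L₀ : ℝ}
    (hG : GeoOK (geo9K i)) (hFa : Facts347 (geo9K i) R₀ H₀ dF δF α L₀) (hcf : |i.cf| = (B6Prop22KLevelTorusCensusEta.nKT (toKT i) : ℝ))
    (hβ1 : ∀ f : FBondY i, (geomT i.D).dist (β i.hN i.D i.hk (bI f)) (blkV1 i.hN i.D f) ≤ 1)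
    (hbI0 : ∀ f : FBondY i, bI f = bI ⟨f.src, 0⟩) {U : B.Cfg}
    (hUG : ∀ (ν : Fin (d + 1)) (x : Site (PV d ℓ i.m i.K hd hL) 0), rd U ν x ∈ specialUnitaryUnits (Fin N)) {ϑF : ℝ} (hϑF : 0 ≤ ϑF)
    (hF : ∀ (y : Site (PV d ℓ i.m i.K hd hL) 0) (μ' ν' : Fin (d + 1)),
      ‖(plaqV (rd U) y μ' ν' : Matrix (Fin N) (Fin N) ℂ) - 1‖ ≤ ϑF * ((((ℓ + 1 : ℕ) : ℝ)) ^ levY i (chartY i y))⁻¹)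
    {σ c : ℝ} (hrow : RowSum (toB6 (geo9K i) R₀ H₀) σ c) {Y : Type} [Fintype Y] {W : Type} [Fintype W]
    (𝔬 : Ops (geo9K i) B (XBK κ i) Y W (XSK κ i)) (hDv : 𝔬.Dv U = DvcoKH i b B rd U)
    {Dds : Fin (d + 1) → Module.End ℝ (XBK κ i → ℝ)} (hDds : Dds = fun μ => coordOpK b (fun _ : Fin (d + 1) => cdsBₗ i (rd U) μ))
    {BiD δ₀ δJ BdD δ₃ : ℝ} (hBiD : 0 ≤ BiD) (hδJ : 0 ≤ δJ) (hδ₃ : 0 ≤ δ₃) (hδ₃0 : δ₃ ≤ δ₀) (hδ₃J : δ₃ + σ ≤ δJ - α * δF)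
    (hBdD : ((d : ℝ) + 1) * ((1 + CLip d ℓ) * BiD * (CJG d ℓ b s (thetaL d ℓ ϑF) (w s) δJ * (geo9K i).L) * c) ≤ BdD)
    (h44Ds : ∀ μ, HasMaj (bHZKP (κ := κ) i b (taxiB i B rd U) (R := R₀) (H := H₀) (s := s) hs0.le hs1.le) (cNormR R₀ H₀ 𝔬.blkW hG.lenle 0)
      (𝔬.Dvstar U ∘ₗ (𝔬.G0 U ∘ₗ Dds μ)) (fun a a' => BiD * Real.exp (-(δ₀ * (geo9K i).dist a a')))) :
    HasMaj (bHZPG (κ := κ) i b (taxiS i B rd U) (R := R₀) (H := H₀) w hw0 hw1) (cNormR R₀ H₀ 𝔬.blkW hG.lenle 0) (𝔬.Dvstar U ∘ₗ (𝔬.G0 U ∘ₗ 𝔬.Dv U))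
      (fun a a' => BdD * Real.exp (-(δ₃ * (geo9K i).dist a a'))) := by
  have hU : ∀ (ν : Fin (d + 1)) (x : Site (PV d ℓ i.m i.K hd hL) 0), ‖(rd U ν x : Matrix (Fin N) (Fin N) ℂ)‖ ≤ 1 ∧
      ‖(((rd U ν x)⁻¹ : (Matrix (Fin N) (Fin N) ℂ)ˣ) : Matrix (Fin N) (Fin N) ℂ)‖ ≤ 1 := fun ν x => specialUnitaryUnits_le_U1 (hUG ν x)
  have hDv' : 𝔬.Dv U = ∑ μ, Dds μ ∘ₗ JcoKH i b B rd μ U := by rw [hDv, hDds]; exact DvcoKH_eq_sum i b B rd U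
  have hJ := fun μ => hJ_print i B rd b w hw0 hw1 hs0 hs1 hws hFa hcf hβ1 hbI0 hU hϑF hF hδJ μ
  have hCJ : 0 ≤ CJG d ℓ b s (thetaL d ℓ ϑF) (w s) δJ * (geo9K i).L :=
    mul_nonneg (CJG_nonneg (d := d) (ℓ := ℓ) b (thetaL_nonneg d ℓ hϑF) hws δJ) (le_trans zero_le_one hFa.one_le_L)
  have hBdD' : (Fintype.card (Fin (d + 1)) : ℝ) * ((bHZKP (κ := κ) i b (taxiB i B rd U) (R := R₀) (H := H₀) (s := s) hs0.le hs1.le).κ * BiD *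
      (CJG d ℓ b s (thetaL d ℓ ϑF) (w s) δJ * (geo9K i).L) * c) ≤ BdD := by
    rw [Fintype.card_fin, Nat.cast_add, Nat.cast_one, bHZKP_κ]; exact hBdD
  exact h44DsDv_of_h44Ds hG hrow hBiD hCJ hδ₃ hδ₃0 hδ₃J hBdD' hDv' h44Ds hJ

/-- ★★ **`Letters313DMZ.dgDHd ν` AT THE PRINT-WEIGHTED PIN `bH13 := bHZPG (taxiS U) w`** — ∇_{U,ν}G₀D_U : bH13 → 𝔠⁽¹⁾ from the PRINT-LITERAL (3.44) members `h44m′ μ`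
(∇_{U,ν}G₀∇\*_{U,μ} : `bHZKP (taxiB U) s → 𝔠⁽¹⁾`) and the print-weighted J-letter; `B₃ ≥ (d+1)·(1 + C_Lip)·B_i·(CJG(s)·L)·c`, `0 ≤ δ₃ ≤ δ₀`, `δ₃ + σ ≤ δ_J − αδ_F`.
[cite: Balaban1985BackgroundPropagators, Thm 3.3 (3.44) p.398 + (3.152)–(3.153) p.426 + (3.3) p.390 + (3.35) p.396; Balaban1984PropagatorsII, (2.26) p.228 + (2.52)–(2.56) pp.232–233 + Lemma 2.1 (2.60)–(2.61) p.234] -/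
theorem dgDHd_pins_print {R₀ : ℝ} {H₀ : Prop} {dF : ℕ} {δF α L₀ : ℝ}
    (hG : GeoOK (geo9K i)) (hFa : Facts347 (geo9K i) R₀ H₀ dF δF α L₀) (hcf : |i.cf| = (B6Prop22KLevelTorusCensusEta.nKT (toKT i) : ℝ))
    (hβ1 : ∀ f : FBondY i, (geomT i.D).dist (β i.hN i.D i.hk (bI f)) (blkV1 i.hN i.D f) ≤ 1)
    (hbI0 : ∀ f : FBondY i, bI f = bI ⟨f.src, 0⟩) {U : B.Cfg}
    (hUG : ∀ (ν : Fin (d + 1)) (x : Site (PV d ℓ i.m i.K hd hL) 0), rd U ν x ∈ specialUnitaryUnits (Fin N)) {ϑF : ℝ} (hϑF : 0 ≤ ϑF)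
    (hF : ∀ (y : Site (PV d ℓ i.m i.K hd hL) 0) (μ' ν' : Fin (d + 1)),
      ‖(plaqV (rd U) y μ' ν' : Matrix (Fin N) (Fin N) ℂ) - 1‖ ≤ ϑF * ((((ℓ + 1 : ℕ) : ℝ)) ^ levY i (chartY i y))⁻¹)
    {σ c : ℝ} (hrow : RowSum (toB6 (geo9K i) R₀ H₀) σ c) {Y : Type} [Fintype Y] {W : Type} [Fintype W]
    (𝔬 : Ops (geo9K i) B (XBK κ i) Y W (XSK κ i)) (hDv : 𝔬.Dv U = DvcoKH i b B rd U)
    {Dds : Fin (d + 1) → Module.End ℝ (XBK κ i → ℝ)} (hDds : Dds = fun μ => coordOpK b (fun _ : Fin (d + 1) => cdsBₗ i (rd U) μ))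
    {Ddν : Module.End ℝ (XBK κ i → ℝ)} {Bi δ₀ δJ B₃ δ₃ : ℝ} (hBi : 0 ≤ Bi) (hc : 0 ≤ c) (hδJ : 0 ≤ δJ)
    (hδ₃ : 0 ≤ δ₃) (hδ₃0 : δ₃ ≤ δ₀) (hδ₃J : δ₃ + σ ≤ δJ - α * δF)
    (hB₃ : ((d : ℝ) + 1) * ((1 + CLip d ℓ) * Bi * (CJG d ℓ b s (thetaL d ℓ ϑF) (w s) δJ * (geo9K i).L) * c) ≤ B₃)
    (h44m : ∀ μ, HasMaj (bHZKP (κ := κ) i b (taxiB i B rd U) (R := R₀) (H := H₀) (s := s) hs0.le hs1.le) (cNorm R₀ H₀ 𝔬.blk hG.lenle 1)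
      (Ddν ∘ₗ (𝔬.G0 U ∘ₗ Dds μ)) (fun a a' => Bi * Real.exp (-(δ₀ * (geo9K i).dist a a')))) :
    HasMaj (bHZPG (κ := κ) i b (taxiS i B rd U) (R := R₀) (H := H₀) w hw0 hw1) (cNorm R₀ H₀ 𝔬.blk hG.lenle 1) (Ddν ∘ₗ 𝔬.G0 U ∘ₗ 𝔬.Dv U)
      (fun a a' => B₃ * Real.exp (-(δ₃ * (geo9K i).dist a a'))) := by
  have hU : ∀ (ν : Fin (d + 1)) (x : Site (PV d ℓ i.m i.K hd hL) 0), ‖(rd U ν x : Matrix (Fin N) (Fin N) ℂ)‖ ≤ 1 ∧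
      ‖(((rd U ν x)⁻¹ : (Matrix (Fin N) (Fin N) ℂ)ˣ) : Matrix (Fin N) (Fin N) ℂ)‖ ≤ 1 := fun ν x => specialUnitaryUnits_le_U1 (hUG ν x)
  have hDv' : 𝔬.Dv U = ∑ μ, Dds μ ∘ₗ JcoKH i b B rd μ U := by rw [hDv, hDds]; exact DvcoKH_eq_sum i b B rd U
  have hJ := fun μ => hJ_print i B rd b w hw0 hw1 hs0 hs1 hws hFa hcf hβ1 hbI0 hU hϑF hF hδJ μ
  have hCJ : 0 ≤ CJG d ℓ b s (thetaL d ℓ ϑF) (w s) δJ * (geo9K i).L :=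
    mul_nonneg (CJG_nonneg (d := d) (ℓ := ℓ) b (thetaL_nonneg d ℓ hϑF) hws δJ) (le_trans zero_le_one hFa.one_le_L)
  have hκ : (bHZKP (κ := κ) i b (taxiB i B rd U) (R := R₀) (H := H₀) (s := s) hs0.le hs1.le).κ ≤ 1 + CLip d ℓ := le_of_eq (bHZKP_κ i b _ _ _)
  have hB₃' : (Fintype.card (Fin (d + 1)) : ℝ) * ((1 + CLip d ℓ) * Bi * (CJG d ℓ b s (thetaL d ℓ ϑF) (w s) δJ * (geo9K i).L) * c) ≤ B₃ := by
    rw [Fintype.card_fin, Nat.cast_add, Nat.cast_one]; exact hB₃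
  exact dgDHd_of_h44m_one hG hrow hBi hCJ hc hκ hδ₃ hδ₃0 hδ₃J hB₃' hDv' h44m hJ

/-- ★★ **`Letters313DZ.dgDH` AT THE PRINT-WEIGHTED PIN** — ∇_UG₀D_U : bH13 → 𝔠_Y⁽¹⁾ with the slice-diagonal `∇_U` (`hD`: `DcoK = Σ_ν Π_ν∘∇_{U,ν}`, the Π-letter
`hasMaj_sliceProjK_cNorm`), from the print-literal `h44m′ ν μ` and the print-weighted J-letter; `B₃` per ν as in `dgDHd_pins_print`, then `B₃p ≥ (d+1)·B₃·c`.
[cite: Balaban1985BackgroundPropagators, Thm 3.13 p.426 + Thm 3.3 (3.44) p.398 + (3.42) p.397 + (3.152)–(3.153) p.426 + (3.3) p.390; Balaban1984PropagatorsII, (2.52)–(2.56) pp.232–233 + Lemma 2.1 (2.60)–(2.61) p.234] -/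
theorem dgDH_pins_print {R₀ : ℝ} {H₀ : Prop} {dF : ℕ} {δF α L₀ : ℝ}
    (hG : GeoOK (geo9K i)) (hFa : Facts347 (geo9K i) R₀ H₀ dF δF α L₀) (hcf : |i.cf| = (B6Prop22KLevelTorusCensusEta.nKT (toKT i) : ℝ))
    (hβ1 : ∀ f : FBondY i, (geomT i.D).dist (β i.hN i.D i.hk (bI f)) (blkV1 i.hN i.D f) ≤ 1)
    (hbI0 : ∀ f : FBondY i, bI f = bI ⟨f.src, 0⟩) {U : B.Cfg}
    (hUG : ∀ (ν : Fin (d + 1)) (x : Site (PV d ℓ i.m i.K hd hL) 0), rd U ν x ∈ specialUnitaryUnits (Fin N)) {ϑF : ℝ} (hϑF : 0 ≤ ϑF)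
    (hF : ∀ (y : Site (PV d ℓ i.m i.K hd hL) 0) (μ' ν' : Fin (d + 1)),
      ‖(plaqV (rd U) y μ' ν' : Matrix (Fin N) (Fin N) ℂ) - 1‖ ≤ ϑF * ((((ℓ + 1 : ℕ) : ℝ)) ^ levY i (chartY i y))⁻¹)
    {σ c : ℝ} (hrow : RowSum (toB6 (geo9K i) R₀ H₀) σ c) {W : Type} [Fintype W]
    (𝔬 : Ops (geo9K i) B (XBK κ i) (XBK κ i) W (XSK κ i)) (hblk : 𝔬.blk = blkBK i bI) (hblkY : 𝔬.blkY = blkBK i bI)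
    (hDv : 𝔬.Dv U = DvcoKH i b B rd U) (hD : 𝔬.D U = B9CoReadingCoords.DcoK i b B rd U)
    {Dd Dds : Fin (d + 1) → Module.End ℝ (XBK κ i → ℝ)}
    (hDd : Dd = fun ν => coordOpK b (fun _ : Fin (d + 1) => cdBₗ i (rd U) ν))
    (hDds : Dds = fun μ => coordOpK b (fun _ : Fin (d + 1) => cdsBₗ i (rd U) μ))
    {Bi δ₀ δJ B₃ δ₃ B₃p : ℝ} (hBi : 0 ≤ Bi) (hc : 0 ≤ c) (hδJ : 0 ≤ δJ)
    (hδ₃ : 0 ≤ δ₃) (hδ₃0 : δ₃ ≤ δ₀) (hδ₃J : δ₃ + σ ≤ δJ - α * δF)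
    (hB₃ : ((d : ℝ) + 1) * ((1 + CLip d ℓ) * Bi * (CJG d ℓ b s (thetaL d ℓ ϑF) (w s) δJ * (geo9K i).L) * c) ≤ B₃)
    (hB₃p : ((d : ℝ) + 1) * (1 * B₃ * c) ≤ B₃p)
    (h44m : ∀ ν μ, HasMaj (bHZKP (κ := κ) i b (taxiB i B rd U) (R := R₀) (H := H₀) (s := s) hs0.le hs1.le) (cNorm R₀ H₀ 𝔬.blk hG.lenle 1)
      (Dd ν ∘ₗ (𝔬.G0 U ∘ₗ Dds μ)) (fun a a' => Bi * Real.exp (-(δ₀ * (geo9K i).dist a a')))) :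
    HasMaj (bHZPG (κ := κ) i b (taxiS i B rd U) (R := R₀) (H := H₀) w hw0 hw1) (cNorm R₀ H₀ 𝔬.blkY hG.lenle 1) (𝔬.D U ∘ₗ 𝔬.G0 U ∘ₗ 𝔬.Dv U)
      (fun a a' => B₃p * Real.exp (-(δ₃ * (geo9K i).dist a a'))) := by
  have hU : ∀ (ν : Fin (d + 1)) (x : Site (PV d ℓ i.m i.K hd hL) 0), ‖(rd U ν x : Matrix (Fin N) (Fin N) ℂ)‖ ≤ 1 ∧
      ‖(((rd U ν x)⁻¹ : (Matrix (Fin N) (Fin N) ℂ)ˣ) : Matrix (Fin N) (Fin N) ℂ)‖ ≤ 1 := fun ν x => specialUnitaryUnits_le_U1 (hUG ν x)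
  have hDv' : 𝔬.Dv U = ∑ μ, Dds μ ∘ₗ JcoKH i b B rd μ U := by rw [hDv, hDds]; exact DvcoKH_eq_sum i b B rd U
  have hD' : 𝔬.D U = ∑ ν, sliceProjK ν ∘ₗ Dd ν := by rw [hD, hDd]; exact DcoK_eq_sum i b B rd U
  have hJ := fun μ => hJ_print i B rd b w hw0 hw1 hs0 hs1 hws hFa hcf hβ1 hbI0 hU hϑF hF hδJ μ
  have hPr : ∀ ν, HasMaj (cNorm R₀ H₀ 𝔬.blk hG.lenle 1) (cNorm R₀ H₀ 𝔬.blkY hG.lenle 1) (sliceProjK (κ := κ) ν)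
      (fun a a' => (1 : ℝ) * Real.exp (-((δ₃ + σ) * (geo9K i).dist a a'))) := fun ν => by
    rw [hblk, hblkY]; exact hasMaj_sliceProjK_cNorm i (blkBK i bI) hG.lenle 1 ν
  have hCJ : 0 ≤ CJG d ℓ b s (thetaL d ℓ ϑF) (w s) δJ * (geo9K i).L :=
    mul_nonneg (CJG_nonneg (d := d) (ℓ := ℓ) b (thetaL_nonneg d ℓ hϑF) hws δJ) (le_trans zero_le_one hFa.one_le_L)
  have hκ : (bHZKP (κ := κ) i b (taxiB i B rd U) (R := R₀) (H := H₀) (s := s) hs0.le hs1.le).κ ≤ 1 + CLip d ℓ := le_of_eq (bHZKP_κ i b _ _ _)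
  have hB₃a : (Fintype.card (Fin (d + 1)) : ℝ) * ((1 + CLip d ℓ) * Bi * (CJG d ℓ b s (thetaL d ℓ ϑF) (w s) δJ * (geo9K i).L) * c) ≤ B₃ := by
    rw [Fintype.card_fin, Nat.cast_add, Nat.cast_one]; exact hB₃
  have hB₃b : (Fintype.card (Fin (d + 1)) : ℝ) * (1 * B₃ * c) ≤ B₃p := by
    rw [Fintype.card_fin, Nat.cast_add, Nat.cast_one]; exact hB₃p
  exact dgDH_of_h44m_one hG hrow hBi hCJ zero_le_one hc hκ hδ₃ hδ₃0 hδ₃J hB₃a hδ₃ le_rfl le_rfl hB₃b hDv' hD' h44m hJ hPr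

/-- ★★ **`Letters313HZ.pYDH β` AT THE PRINT-WEIGHTED PIN** — Φ^Y_β∘∇_U∘G₀∘D_U : bH13 → 𝔠_{P_Y}^{(β−1)} from the PRINT-LITERAL (3.45) members `h45Y′ μ`
(`bHZKP (taxiB U) s → 𝔠_{P_Y}^{(β−1)}`, inhabitable for `s > β`: input exponent `β + ε`) and the print-weighted J-letter; `BhD ≥ (d+1)·(1 + C_Lip)·B_i·(CJG(s)·L)·c`.
[cite: Balaban1985BackgroundPropagators, Thm 3.13 p.426 + (3.45) p.398 + (3.152)–(3.153) p.426 + (3.3) p.390 + (3.35) p.396; Balaban1984PropagatorsII, (2.26) p.228 + (2.52)–(2.56) pp.232–233 + Lemma 2.1 (2.60)–(2.61) p.234] -/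
theorem pYDH_pins_print {R₀ : ℝ} {H₀ : Prop} {dF : ℕ} {δF α L₀ : ℝ}
    (hG : GeoOK (geo9K i)) (hFa : Facts347 (geo9K i) R₀ H₀ dF δF α L₀) (hcf : |i.cf| = (B6Prop22KLevelTorusCensusEta.nKT (toKT i) : ℝ))
    (hβ1 : ∀ f : FBondY i, (geomT i.D).dist (β i.hN i.D i.hk (bI f)) (blkV1 i.hN i.D f) ≤ 1)
    (hbI0 : ∀ f : FBondY i, bI f = bI ⟨f.src, 0⟩) {U : B.Cfg}
    (hUG : ∀ (ν : Fin (d + 1)) (x : Site (PV d ℓ i.m i.K hd hL) 0), rd U ν x ∈ specialUnitaryUnits (Fin N)) {ϑF : ℝ} (hϑF : 0 ≤ ϑF)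
    (hF : ∀ (y : Site (PV d ℓ i.m i.K hd hL) 0) (μ' ν' : Fin (d + 1)),
      ‖(plaqV (rd U) y μ' ν' : Matrix (Fin N) (Fin N) ℂ) - 1‖ ≤ ϑF * ((((ℓ + 1 : ℕ) : ℝ)) ^ levY i (chartY i y))⁻¹)
    {σ c : ℝ} (hrow : RowSum (toB6 (geo9K i) R₀ H₀) σ c) {Y : Type} [Fintype Y] {W : Type} [Fintype W] {PY : Type} [Fintype PY]
    (𝔬 : Ops (geo9K i) B (XBK κ i) Y W (XSK κ i)) (𝔭 : HolderProbes (geo9K i) B (XBK κ i) Y (XBK κ i) PY) (hDv : 𝔬.Dv U = DvcoKH i b B rd U)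
    {Dds : Fin (d + 1) → Module.End ℝ (XBK κ i → ℝ)} (hDds : Dds = fun μ => coordOpK b (fun _ : Fin (d + 1) => cdsBₗ i (rd U) μ))
    {βH Bi δ₀ δJ BhD δ₃ : ℝ} (hBi : 0 ≤ Bi) (hc : 0 ≤ c) (hδJ : 0 ≤ δJ)
    (hδ₃ : 0 ≤ δ₃) (hδ₃0 : δ₃ ≤ δ₀) (hδ₃J : δ₃ + σ ≤ δJ - α * δF)
    (hBhD : ((d : ℝ) + 1) * ((1 + CLip d ℓ) * Bi * (CJG d ℓ b s (thetaL d ℓ ϑF) (w s) δJ * (geo9K i).L) * c) ≤ BhD)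
    (h45Y : ∀ μ, HasMaj (bHZKP (κ := κ) i b (taxiB i B rd U) (R := R₀) (H := H₀) (s := s) hs0.le hs1.le) (cNormR R₀ H₀ 𝔭.blkPY hG.lenle (βH - 1))
      (𝔭.ΦY U βH ∘ₗ (𝔬.D U ∘ₗ (𝔬.G0 U ∘ₗ Dds μ))) (fun a a' => Bi * Real.exp (-(δ₀ * (geo9K i).dist a a')))) :
    HasMaj (bHZPG (κ := κ) i b (taxiS i B rd U) (R := R₀) (H := H₀) w hw0 hw1) (cNormR R₀ H₀ 𝔭.blkPY hG.lenle (βH - 1))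
      ((𝔭.ΦY U βH ∘ₗ 𝔬.D U ∘ₗ 𝔬.G0 U) ∘ₗ 𝔬.Dv U) (fun a a' => BhD * Real.exp (-(δ₃ * (geo9K i).dist a a'))) := by
  have hU : ∀ (ν : Fin (d + 1)) (x : Site (PV d ℓ i.m i.K hd hL) 0), ‖(rd U ν x : Matrix (Fin N) (Fin N) ℂ)‖ ≤ 1 ∧
      ‖(((rd U ν x)⁻¹ : (Matrix (Fin N) (Fin N) ℂ)ˣ) : Matrix (Fin N) (Fin N) ℂ)‖ ≤ 1 := fun ν x => specialUnitaryUnits_le_U1 (hUG ν x)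
  have hDv' : 𝔬.Dv U = ∑ μ, Dds μ ∘ₗ JcoKH i b B rd μ U := by rw [hDv, hDds]; exact DvcoKH_eq_sum i b B rd U
  have hJ := fun μ => hJ_print i B rd b w hw0 hw1 hs0 hs1 hws hFa hcf hβ1 hbI0 hU hϑF hF hδJ μ
  have hCJ : 0 ≤ CJG d ℓ b s (thetaL d ℓ ϑF) (w s) δJ * (geo9K i).L :=
    mul_nonneg (CJG_nonneg (d := d) (ℓ := ℓ) b (thetaL_nonneg d ℓ hϑF) hws δJ) (le_trans zero_le_one hFa.one_le_L)
  have hκ : (bHZKP (κ := κ) i b (taxiB i B rd U) (R := R₀) (H := H₀) (s := s) hs0.le hs1.le).κ ≤ 1 + CLip d ℓ := le_of_eq (bHZKP_κ i b _ _ _)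
  have hBhD' : (Fintype.card (Fin (d + 1)) : ℝ) * ((1 + CLip d ℓ) * Bi * (CJG d ℓ b s (thetaL d ℓ ϑF) (w s) δJ * (geo9K i).L) * c) ≤ BhD := by
    rw [Fintype.card_fin, Nat.cast_add, Nat.cast_one]; exact hBhD
  exact pYDH_of_h45Y_one hG hrow hBi hCJ hc hκ hδ₃ hδ₃0 hδ₃J hBhD' hDv' h45Y hJ

/-- ★★ (v1.1) **`Letters313HZ.pYDH β` AT THE PRINT-WEIGHTED PIN, FREE PROBE-LATTICE TYPE `PX`** (dag-n06-d g16's NIT, INBOX 2026-08-29T01:19Z: v1.0's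
`pYDH_pins_print` pins the X-probe slot of `HolderProbes` to `XBK κ i`, while the record has `PX = PK (FBondY …) (Fin (d+1)) κ`; this twin frees it) — Φ^Y_β∘∇_U∘G₀∘D_U : bH13 → 𝔠_{P_Y}^{(β−1)} from the PRINT-LITERAL (3.45) members `h45Y′ μ`
(`bHZKP (taxiB U) s → 𝔠_{P_Y}^{(β−1)}`, inhabitable for `s > β`: input exponent `β + ε`) and the print-weighted J-letter; `BhD ≥ (d+1)·(1 + C_Lip)·B_i·(CJG(s)·L)·c`.
[cite: Balaban1985BackgroundPropagators, Thm 3.13 p.426 + (3.45) p.398 + (3.152)–(3.153) p.426 + (3.3) p.390 + (3.35) p.396; Balaban1984PropagatorsII, (2.26) p.228 + (2.52)–(2.56) pp.232–233 + Lemma 2.1 (2.60)–(2.61) p.234] -/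
theorem pYDH_pins_print' {R₀ : ℝ} {H₀ : Prop} {dF : ℕ} {δF α L₀ : ℝ}
    (hG : GeoOK (geo9K i)) (hFa : Facts347 (geo9K i) R₀ H₀ dF δF α L₀) (hcf : |i.cf| = (B6Prop22KLevelTorusCensusEta.nKT (toKT i) : ℝ))
    (hβ1 : ∀ f : FBondY i, (geomT i.D).dist (β i.hN i.D i.hk (bI f)) (blkV1 i.hN i.D f) ≤ 1)
    (hbI0 : ∀ f : FBondY i, bI f = bI ⟨f.src, 0⟩) {U : B.Cfg}
    (hUG : ∀ (ν : Fin (d + 1)) (x : Site (PV d ℓ i.m i.K hd hL) 0), rd U ν x ∈ specialUnitaryUnits (Fin N)) {ϑF : ℝ} (hϑF : 0 ≤ ϑF)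
    (hF : ∀ (y : Site (PV d ℓ i.m i.K hd hL) 0) (μ' ν' : Fin (d + 1)),
      ‖(plaqV (rd U) y μ' ν' : Matrix (Fin N) (Fin N) ℂ) - 1‖ ≤ ϑF * ((((ℓ + 1 : ℕ) : ℝ)) ^ levY i (chartY i y))⁻¹)
    {σ c : ℝ} (hrow : RowSum (toB6 (geo9K i) R₀ H₀) σ c) {Y : Type} [Fintype Y] {W : Type} [Fintype W] {PX PY : Type} [Fintype PX] [Fintype PY]
    (𝔬 : Ops (geo9K i) B (XBK κ i) Y W (XSK κ i)) (𝔭 : HolderProbes (geo9K i) B (XBK κ i) Y PX PY) (hDv : 𝔬.Dv U = DvcoKH i b B rd U)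
    {Dds : Fin (d + 1) → Module.End ℝ (XBK κ i → ℝ)} (hDds : Dds = fun μ => coordOpK b (fun _ : Fin (d + 1) => cdsBₗ i (rd U) μ))
    {βH Bi δ₀ δJ BhD δ₃ : ℝ} (hBi : 0 ≤ Bi) (hc : 0 ≤ c) (hδJ : 0 ≤ δJ)
    (hδ₃ : 0 ≤ δ₃) (hδ₃0 : δ₃ ≤ δ₀) (hδ₃J : δ₃ + σ ≤ δJ - α * δF)
    (hBhD : ((d : ℝ) + 1) * ((1 + CLip d ℓ) * Bi * (CJG d ℓ b s (thetaL d ℓ ϑF) (w s) δJ * (geo9K i).L) * c) ≤ BhD)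
    (h45Y : ∀ μ, HasMaj (bHZKP (κ := κ) i b (taxiB i B rd U) (R := R₀) (H := H₀) (s := s) hs0.le hs1.le) (cNormR R₀ H₀ 𝔭.blkPY hG.lenle (βH - 1))
      (𝔭.ΦY U βH ∘ₗ (𝔬.D U ∘ₗ (𝔬.G0 U ∘ₗ Dds μ))) (fun a a' => Bi * Real.exp (-(δ₀ * (geo9K i).dist a a')))) :
    HasMaj (bHZPG (κ := κ) i b (taxiS i B rd U) (R := R₀) (H := H₀) w hw0 hw1) (cNormR R₀ H₀ 𝔭.blkPY hG.lenle (βH - 1))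
      ((𝔭.ΦY U βH ∘ₗ 𝔬.D U ∘ₗ 𝔬.G0 U) ∘ₗ 𝔬.Dv U) (fun a a' => BhD * Real.exp (-(δ₃ * (geo9K i).dist a a'))) := by
  have hU : ∀ (ν : Fin (d + 1)) (x : Site (PV d ℓ i.m i.K hd hL) 0), ‖(rd U ν x : Matrix (Fin N) (Fin N) ℂ)‖ ≤ 1 ∧
      ‖(((rd U ν x)⁻¹ : (Matrix (Fin N) (Fin N) ℂ)ˣ) : Matrix (Fin N) (Fin N) ℂ)‖ ≤ 1 := fun ν x => specialUnitaryUnits_le_U1 (hUG ν x)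
  have hDv' : 𝔬.Dv U = ∑ μ, Dds μ ∘ₗ JcoKH i b B rd μ U := by rw [hDv, hDds]; exact DvcoKH_eq_sum i b B rd U
  have hJ := fun μ => hJ_print i B rd b w hw0 hw1 hs0 hs1 hws hFa hcf hβ1 hbI0 hU hϑF hF hδJ μ
  have hCJ : 0 ≤ CJG d ℓ b s (thetaL d ℓ ϑF) (w s) δJ * (geo9K i).L :=
    mul_nonneg (CJG_nonneg (d := d) (ℓ := ℓ) b (thetaL_nonneg d ℓ hϑF) hws δJ) (le_trans zero_le_one hFa.one_le_L)
  have hκ : (bHZKP (κ := κ) i b (taxiB i B rd U) (R := R₀) (H := H₀) (s := s) hs0.le hs1.le).κ ≤ 1 + CLip d ℓ := le_of_eq (bHZKP_κ i b _ _ _)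
  have hBhD' : (Fintype.card (Fin (d + 1)) : ℝ) * ((1 + CLip d ℓ) * Bi * (CJG d ℓ b s (thetaL d ℓ ϑF) (w s) δJ * (geo9K i).L) * c) ≤ BhD := by
    rw [Fintype.card_fin, Nat.cast_add, Nat.cast_one]; exact hBhD
  exact pYDH_of_h45Y_one hG hrow hBi hCJ hc hκ hδ₃ hδ₃0 hδ₃J hBhD' hDv' h45Y hJ

end Members

end Literature.MathematicalPhysics.QuantumFieldTheory.Balaban1983to89.B9Thm313WholeDvHolderAtPinsPrint

end
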